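import Mathlib.Analysis.Normed.Operator.ContinuousLinearMap
import Mathlib.Analysis.Normed.Group.InfiniteSum
import Mathlib.Analysis.SpecificLimits.Basic
import Mathlib.Topology.Algebra.InfiniteSum.Module
import Mathlib.Topology.Algebra.InfiniteSum.NatInt
import Mathlib.Topology.ContinuousMap.Bounded.Normed
import Mathlib.Topology.MetricSpace.Contracting
import HarnessLib

/-!
# Shadowing for a sequence of maps of a Banach space, I: hyperbolic sequences (Pilyugin 1999, §1.3.1)

Topic `Literature/Dynamics/Hyperbolic`.  This file and its three sequels
(`SequenceShadowingGreen`, `SequenceShadowingExistence`, `SequenceShadowingUniqueness`) formalise the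
"abstract" shadowing theorem for a SEQUENCE OF MAPS `φ_k = A_k + w_k` of a Banach space with
`(λ, N)`-hyperbolic, possibly NON-INVERTIBLE linear parts — S. Yu. Pilyugin, *Shadowing in Dynamical
Systems*, Lecture Notes in Math. 1706 (Springer 1999), §1.3.1, Lemma 1.3.1 and Theorem 1.3.1 (existence of
a shadowing trajectory `‖v_k‖ ≤ L d`, `L = N₁/(1 - κN₁)`, `N₁ = N(1+λ)/(1-λ)`, `d₀ = Δ/L`), and a
uniqueness statement in the spirit of §1.3.2, Theorem 1.3.2.  It is the common analytic kernel of the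
classical Shadowing Lemma near a hyperbolic set (Pilyugin §1.2, Thm 1.2.3 via §1.3.3), of the
Chow–Lin–Palmer / Steinlein–Walther shadowing theorems for `C¹` maps of Banach spaces (Pilyugin §1.3.4),
and of Katok's closing lemma read in Lyapunov charts; everything is proved, nothing is asserted.

## Contents of this file

* `stableSpace P k`, `unstableSpace P k` — the parts `S_k = P_k E`, `U_k = (I - P_k) E` of the
  `k`-dependent splitting given by bounded projectors `P k : E →L[ℝ] E`, `k ∈ ℤ`;
* `IsHyperbolicSequence A P B lam N` — Pilyugin's conditions (a), (b) of Theorem 1.3.1 (norms of the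
  projectors `≤ N`, `A_k S_k ⊆ S_{k+1}` with contraction `λ`, right inverses `B_k` of `A_k` on `U_{k+1}`
  mapping `U_{k+1} → U_k` with `‖B_k|‖ ≤ λ`);
* `stableChain A n m = A_{n-1} ∘ ⋯ ∘ A_{n-m}`, `unstableChain B n m = B_n ∘ ⋯ ∘ B_{n+m}` and their
  contraction / invariance along the splitting (`stableChain_apply`, `unstableChain_apply`).

## Design choices

* ONE ambient real normed space `E` with a `k`-dependent splitting (Pilyugin allows different Banach spaces
  `H_k`; every application in view — Lyapunov charts, Poincaré sections conjugated into a fixed space — is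
  covered; the general form is recorded as a TODO in the docstrings).  Two-sided sequences `k ∈ ℤ` only.
* The right inverses `B_k` are bounded operators of `E`; only their values on `U_{k+1}` matter.
* `Q_k` is not separate data: `Q_k = 1 - P_k` throughout (`P_k + Q_k = I` by construction).
* Mathlib (this pin) has no shadowing / pseudo-orbit / exponential-dichotomy notion (`lean search` for
  `hadowing`, `pseudoOrbit`, `Dichotomy`: nothing relevant); the tree's `Literature.Dynamics.FixedPoints`
  (hyperbolic fixed points in a Banach chart) is about a single operator and is not used here.

## References

* S. Yu. Pilyugin, *Shadowing in Dynamical Systems*, LNM 1706, Springer 1999, §1.3.1 (pp. 35–38: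
  Lemma 1.3.1, Theorem 1.3.1, Examples 1.12–1.13), §1.3.2 (Theorem 1.3.2). [Pilyugin1999]
-/

noncomputable section

open Filter Set Function
open scoped Topology NNReal

namespace Literature.Dynamics.Hyperbolic

variable {E : Type*} [NormedAddCommGroup E] [NormedSpace ℝ E]

/-! ## §1 Hyperbolic sequences of linear maps (Pilyugin's conditions (a), (b)) -/

/-- The STABLE part `S_k = P_k E` of the splitting given by the projectors `P k`. [folklore] -/
def stableSpace (P : ℤ → E →L[ℝ] E) (k : ℤ) : Submodule ℝ E :=
  LinearMap.range ((P k : E →L[ℝ] E) : E →ₗ[ℝ] E)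

/-- The UNSTABLE part `U_k = Q_k E`, `Q_k = I - P_k`. [folklore] -/
def unstableSpace (P : ℤ → E →L[ℝ] E) (k : ℤ) : Submodule ℝ E :=
  LinearMap.range ((((1 : E →L[ℝ] E) - P k : E →L[ℝ] E)) : E →ₗ[ℝ] E)

/-- Membership in the stable part. [folklore] -/
theorem mem_stableSpace {P : ℤ → E →L[ℝ] E} {k : ℤ} {v : E} :
    v ∈ stableSpace P k ↔ ∃ w, P k w = v := LinearMap.mem_range

/-- Membership in the unstable part. [folklore] -/
theorem mem_unstableSpace {P : ℤ → E →L[ℝ] E} {k : ℤ} {v : E} :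
    v ∈ unstableSpace P k ↔ ∃ w, ((1 : E →L[ℝ] E) - P k) w = v := LinearMap.mem_range

/-- `P_k w ∈ S_k`. [folklore] -/
theorem apply_mem_stableSpace (P : ℤ → E →L[ℝ] E) (k : ℤ) (w : E) : P k w ∈ stableSpace P k :=
  mem_stableSpace.2 ⟨w, rfl⟩

/-- `Q_k w ∈ U_k`. [folklore] -/
theorem apply_mem_unstableSpace (P : ℤ → E →L[ℝ] E) (k : ℤ) (w : E) :
    ((1 : E →L[ℝ] E) - P k) w ∈ unstableSpace P k :=
  mem_unstableSpace.2 ⟨w, rfl⟩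


/-- **Hyperbolic sequence of bounded linear maps** `A k : E →L[ℝ] E`, `k ∈ ℤ`, of ONE real normed
space, with constants `λ ∈ (0,1)`, `N ≥ 1` — conditions (a) and (b) of Pilyugin's Theorem 1.3.1 in the
special case `H_k = E` for all `k`: bounded projectors `P k` (stable part `S_k = P_k E`) and
`Q_k = 1 - P_k` (unstable part `U_k = Q_k E`) of norm `≤ N`; `A_k S_k ⊆ S_{k+1}` with
`‖A_k|_{S_k}‖ ≤ λ`; and linear right inverses `B k` of `A k` on `U_{k+1}` with `B_k U_{k+1} ⊆ U_k`,
`‖B_k|_{U_{k+1}}‖ ≤ λ`, `A_k B_k = I` on `U_{k+1}` (the linear parts `A_k` need not be invertible).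
The `B k` are taken as bounded operators of `E` whose values off `U_{k+1}` are irrelevant.
Idempotence of `P k` ("projector") is recorded; the existence theorem does not use it, the
uniqueness theorem does.
-- TODO(general form): Pilyugin allows a sequence of DIFFERENT Banach spaces `H_k` (and `k ∈ ℤ₊`).
[cite: Pilyugin1999, Thm 1.3.1 conditions (a), (b)] -/
structure IsHyperbolicSequence (A P B : ℤ → E →L[ℝ] E) (lam N : ℝ) : Prop where
  /-- `0 < λ`. -/
  lam_pos : 0 < lam
  /-- `λ < 1`. -/
  lam_lt_one : lam < 1
  /-- `1 ≤ N`. -/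
  one_le_N : 1 ≤ N
  /-- `P_k` is a projector. -/
  proj_idem : ∀ (k : ℤ) (v : E), P k (P k v) = P k v
  /-- `‖P_k‖ ≤ N`. -/
  norm_P_le : ∀ k : ℤ, ‖P k‖ ≤ N
  /-- `‖Q_k‖ ≤ N`, `Q_k = I - P_k`. -/
  norm_Q_le : ∀ k : ℤ, ‖(1 : E →L[ℝ] E) - P k‖ ≤ N
  /-- `A_k S_k ⊆ S_{k+1}`. -/
  mapsTo_stable : ∀ (k : ℤ), ∀ v ∈ stableSpace P k, A k v ∈ stableSpace P (k + 1)
  /-- `‖A_k|_{S_k}‖ ≤ λ`. -/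
  contract : ∀ (k : ℤ), ∀ v ∈ stableSpace P k, ‖A k v‖ ≤ lam * ‖v‖
  /-- `B_k U_{k+1} ⊆ U_k`. -/
  mapsTo_unstable : ∀ (k : ℤ), ∀ v ∈ unstableSpace P (k + 1), B k v ∈ unstableSpace P k
  /-- `‖B_k|_{U_{k+1}}‖ ≤ λ`. -/
  inv_contract : ∀ (k : ℤ), ∀ v ∈ unstableSpace P (k + 1), ‖B k v‖ ≤ lam * ‖v‖
  /-- `A_k B_k = I` on `U_{k+1}`. -/
  rightInverse : ∀ (k : ℤ), ∀ v ∈ unstableSpace P (k + 1), A k (B k v) = v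

namespace IsHyperbolicSequence

variable {A P B : ℤ → E →L[ℝ] E} {lam N : ℝ}

/-- `0 ≤ λ`. [folklore] -/
theorem lam_nonneg (h : IsHyperbolicSequence A P B lam N) : 0 ≤ lam := h.lam_pos.le

/-- `0 ≤ N`. [folklore] -/
theorem N_nonneg (h : IsHyperbolicSequence A P B lam N) : 0 ≤ N := zero_le_one.trans h.one_le_N

/-- `0 < 1 - λ`. [folklore] -/
theorem one_sub_lam_pos (h : IsHyperbolicSequence A P B lam N) : 0 < 1 - lam := sub_pos.2 h.lam_lt_one

/-- `‖P_k v‖ ≤ N ‖v‖`. [folklore] -/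
theorem norm_P_apply_le (h : IsHyperbolicSequence A P B lam N) (k : ℤ) (v : E) : ‖P k v‖ ≤ N * ‖v‖ :=
  (ContinuousLinearMap.le_opNorm _ _).trans (mul_le_mul_of_nonneg_right (h.norm_P_le k) (norm_nonneg _))

/-- `‖Q_k v‖ ≤ N ‖v‖`. [folklore] -/
theorem norm_Q_apply_le (h : IsHyperbolicSequence A P B lam N) (k : ℤ) (v : E) :
    ‖((1 : E →L[ℝ] E) - P k) v‖ ≤ N * ‖v‖ :=
  (ContinuousLinearMap.le_opNorm _ _).trans (mul_le_mul_of_nonneg_right (h.norm_Q_le k) (norm_nonneg _))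

end IsHyperbolicSequence

/-! ## §2 Products along the sequence -/

/-- The STABLE CHAIN `A_{n-1} ∘ A_{n-2} ∘ ⋯ ∘ A_{n-m}` (`m` factors; the identity for `m = 0`). [folklore] -/
def stableChain (A : ℤ → E →L[ℝ] E) (n : ℤ) : ℕ → E →L[ℝ] E
  | 0 => 1
  | m + 1 => (stableChain A n m).comp (A (n - (m + 1 : ℕ)))

/-- The UNSTABLE CHAIN `B_n ∘ B_{n+1} ∘ ⋯ ∘ B_{n+m}` (`m + 1` factors). [folklore] -/
def unstableChain (B : ℤ → E →L[ℝ] E) (n : ℤ) : ℕ → E →L[ℝ] E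
  | 0 => B n
  | m + 1 => (unstableChain B n m).comp (B (n + (m + 1 : ℕ)))

/-- Unfolding `stableChain` at `0`. [folklore] -/
@[simp] theorem stableChain_zero (A : ℤ → E →L[ℝ] E) (n : ℤ) : stableChain A n 0 = 1 := rfl

/-- Right unfolding of the stable chain. [folklore] -/
theorem stableChain_succ (A : ℤ → E →L[ℝ] E) (n : ℤ) (m : ℕ) :
    stableChain A n (m + 1) = (stableChain A n m).comp (A (n - (m + 1 : ℕ))) := rfl

/-- LEFT unfolding of the stable chain: `A_{n} ∘ (A_{n-1} ∘ ⋯ ∘ A_{n-m}) = chain of length m+1 at n+1`. [folklore] -/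
theorem stableChain_succ_left (A : ℤ → E →L[ℝ] E) (n : ℤ) (m : ℕ) :
    stableChain A (n + 1) (m + 1) = (A n).comp (stableChain A n m) := by
  induction m with
  | zero =>
    change (1 : E →L[ℝ] E).comp (A (n + 1 - ((0 : ℕ) + 1 : ℕ))) = (A n).comp 1
    have : n + 1 - ((0 : ℕ) + 1 : ℕ) = n := by push_cast; ring
    rw [this, ContinuousLinearMap.one_def, ContinuousLinearMap.id_comp, ContinuousLinearMap.comp_id]
  | succ m ih =>
    rw [stableChain_succ, ih, stableChain_succ, ContinuousLinearMap.comp_assoc]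
    have : n + 1 - ((m + 1 : ℕ) + 1 : ℕ) = n - (m + 1 : ℕ) := by push_cast; ring
    rw [this]

/-- Unfolding `unstableChain` at `0`. [folklore] -/
@[simp] theorem unstableChain_zero (B : ℤ → E →L[ℝ] E) (n : ℤ) : unstableChain B n 0 = B n := rfl

/-- Right unfolding of the unstable chain. [folklore] -/
theorem unstableChain_succ (B : ℤ → E →L[ℝ] E) (n : ℤ) (m : ℕ) :
    unstableChain B n (m + 1) = (unstableChain B n m).comp (B (n + (m + 1 : ℕ))) := rfl

/-- LEFT unfolding of the unstable chain: `B_n ∘ (B_{n+1} ∘ ⋯ ∘ B_{n+1+m})` is the chain of length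
`m + 2` at `n`. [folklore] -/
theorem unstableChain_succ_left (B : ℤ → E →L[ℝ] E) (n : ℤ) (m : ℕ) :
    unstableChain B n (m + 1) = (B n).comp (unstableChain B (n + 1) m) := by
  induction m with
  | zero =>
    change (B n).comp (B (n + ((0 : ℕ) + 1 : ℕ))) = (B n).comp (B (n + 1))
    have : n + ((0 : ℕ) + 1 : ℕ) = n + 1 := by push_cast; ring
    rw [this]
  | succ m ih =>
    rw [unstableChain_succ, ih, unstableChain_succ, ContinuousLinearMap.comp_assoc]
    have : n + ((m + 1 : ℕ) + 1 : ℕ) = n + 1 + (m + 1 : ℕ) := by push_cast; ring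
    rw [this]

namespace IsHyperbolicSequence

variable {A P B : ℤ → E →L[ℝ] E} {lam N : ℝ}

/-- Stable chains contract on the stable part and stay stable:
for `v ∈ S_{n-m}`, `‖A_{n-1}⋯A_{n-m} v‖ ≤ λ^m ‖v‖` and the image lies in `S_n`. [folklore] -/
theorem stableChain_apply (h : IsHyperbolicSequence A P B lam N) (m : ℕ) :
    ∀ (n : ℤ), ∀ v ∈ stableSpace P (n - m),
      ‖stableChain A n m v‖ ≤ lam ^ m * ‖v‖ ∧ stableChain A n m v ∈ stableSpace P n := by
  induction m with
  | zero =>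
    intro n v hv
    simp only [stableChain_zero, one_apply_eq_self, pow_zero, one_mul, le_refl, true_and]
    simpa using hv
  | succ m ih =>
    intro n v hv
    rw [stableChain_succ, ContinuousLinearMap.comp_apply]
    have hk : n - ((m + 1 : ℕ) : ℤ) + 1 = n - (m : ℤ) := by push_cast; ring
    have h1 := h.mapsTo_stable (n - (m + 1 : ℕ)) v hv
    have h2 := h.contract (n - (m + 1 : ℕ)) v hv
    rw [hk] at h1
    obtain ⟨h3, h4⟩ := ih n (A (n - (m + 1 : ℕ)) v) h1
    refine ⟨h3.trans ?_, h4⟩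
    rw [pow_succ, mul_assoc]
    exact mul_le_mul_of_nonneg_left h2 (pow_nonneg h.lam_nonneg _)

/-- Unstable chains contract (backwards) on the unstable part and stay unstable:
for `v ∈ U_{n+m+1}`, `‖B_n⋯B_{n+m} v‖ ≤ λ^{m+1} ‖v‖` and the image lies in `U_n`. [folklore] -/
theorem unstableChain_apply (h : IsHyperbolicSequence A P B lam N) (m : ℕ) :
    ∀ (n : ℤ), ∀ v ∈ unstableSpace P (n + m + 1),
      ‖unstableChain B n m v‖ ≤ lam ^ (m + 1) * ‖v‖ ∧ unstableChain B n m v ∈ unstableSpace P n := by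
  induction m with
  | zero =>
    intro n v hv
    simp only [unstableChain_zero, zero_add, pow_one]
    have hv' : v ∈ unstableSpace P (n + 1) := by simpa using hv
    exact ⟨h.inv_contract n v hv', h.mapsTo_unstable n v hv'⟩
  | succ m ih =>
    intro n v hv
    rw [unstableChain_succ_left, ContinuousLinearMap.comp_apply]
    have hk : n + 1 + (m : ℤ) + 1 = n + ((m + 1 : ℕ) : ℤ) + 1 := by push_cast; ring
    have hv' : v ∈ unstableSpace P (n + 1 + m + 1) := by rwa [hk]
    obtain ⟨h3, h4⟩ := ih (n + 1) v hv'
    refine ⟨(h.inv_contract n _ h4).trans ?_, h.mapsTo_unstable n _ h4⟩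
    rw [pow_succ, mul_comm (lam ^ (m + 1)), mul_assoc]
    exact mul_le_mul_of_nonneg_left h3 h.lam_nonneg

end IsHyperbolicSequence

end Literature.Dynamics.Hyperbolic

end
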